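import Summits.HubbardSuperconductivity.HubbardSuperconductivity.Theorems.AnisotropyChordTransferFibre3N1RowObjTools
import Summits.HubbardSuperconductivity.HubbardSuperconductivity.Theorems.AnisotropyChordTransferFibre3ClosedExpansions
import Summits.HubbardSuperconductivity.HubbardSuperconductivity.Theorems.AnisotropyChordTransferFibre3OuterMajorants
import Summits.HubbardSuperconductivity.HubbardSuperconductivity.Theorems.AnisotropyChordTransferFibre3Regions

/-!
# Route `AnisotropyChord` / H0 rotor rung, LEVEL 2 row `N₁`: the OBJECT `P̂ = θ⁶Σ_k F₂(k)³` lies in its `RExpr` bracket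

First instance of the object layer of the cell-check soundness: for a ground two-magnon profile (`L ≥ 16`, `0 ≤ Δ < 1`) and the true
vector `X = xTrue L Δ λ₂ f a` (`a = Δf(x̂)`),  ★ `pHat_mem`: `(P2lo 2).eval X ≤ θ⁶·Σ_k F₂(k)³ ≤ (P2hi 2).eval X`.
Proof = the blueprint's decomposition made honest: region split `𝕋 = {0} ⊔ block1 ⊔ outer1` (`OuterMaj.singleRegionSplit_holds`),
`F̂(0)`, `F̂(q)` on the block (`eval_F0h`, `eval_Fh`), the closed outer part `θ⁶Σ_{k≠0}c³ − θ⁶Σ_{block}c³` (`pi2ClosedExpansion_holds`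
+ the named-sum identities, `eval_P2closedFull`), and the outer tail `|θ⁶Σ_{outer}(F₂³ − c³)| ≤ P2tailFull − Σ_{block} P2tailAt`
(`OuterMaj.pi2_outer_bound` with the repaired slope `κ̂′`, which is EXACTLY `kap.eval X` by `rho_epsStarR`: `kap_eval`).
Tools: `…N1RowObjTools` (`eval_rsum`, `block1_sum_eq`, `outer1_sum_eq`, `kap_eval`, …).
Prover seat `hubbard-h0-rotor-p2` g4; helper for piece A = stmt-HubbardSuperconductivity-23918 of rung 19089
(`--supports`, helper class).  Nothing here proves superconductivity in the Hubbard model; helper lemmas of ONE conditional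
reduction (the GM₃ ∀L certificate, Level-2 row `N₁`); the rotor TARGET as originally worded stays FALSE (g15 verdict).
Mathlib + the tree only; no sorry.
-/

set_option linter.dupNamespace false
set_option autoImplicit false

open Literature.Analysis.ValidatedNumerics

namespace Summit.HubbardSuperconductivity.HubbardSuperconductivity.Theorems.AnisotropyChord.Transfer.Fibre3.L2.N1

variable (L : ℕ) [NeZero L] (Δ lam2 : ℝ) (f : Tor L → ℝ)

/-! ## The pieces of the `P̂` bracket at the true vector -/

/-- the tail majorant per momentum: `3κ′|c|²g + 3κ′²|c|g² + κ′³g³`, `|c| = 2c_sg + d`. -/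
noncomputable def pMaj (k : Tor L) : ℝ :=
  let κ := kapHat L Δ lam2 f 2 + 2 * aPar L Δ f * cS L Δ lam2 f / (L : ℝ) ^ 2
  let ac := 2 * cS L Δ lam2 f * gres L lam2 k + dPar L Δ f
  3 * κ * ac ^ 2 * gres L lam2 k + 3 * κ ^ 2 * ac * gres L lam2 k ^ 2 + κ ^ 3 * gres L lam2 k ^ 3

/-- base coordinates `1, 4, 5` of the true vector. -/
theorem xTrue_145 (a : ℝ) :
    xTrue L Δ lam2 f a 1 = Real.pi ^ 2 ∧ xTrue L Δ lam2 f a 4 = (2 * Real.pi / L) ^ (2 * 2) * S2n L lam2 ∧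
      xTrue L Δ lam2 f a 5 = (2 * Real.pi / L) ^ (2 * 3) * S3n L lam2 := by
  refine ⟨?_, ?_, ?_⟩ <;> (rw [xTrue_lt16 L Δ lam2 f a (by norm_num)]; rfl)

/-- `P2closedFull ↦ θ⁶Σ_{k≠0} c(k)³` (`Pi2ClosedExpansion`). -/
theorem eval_P2closedFull (hL : 5 ≤ L) (hΔ0 : 0 ≤ Δ) (hΔ1 : Δ < 1) (hf : IsGroundTwoMagnon L Δ lam2 f) (hlam : 0 < lam2)
    (hu : 0 < cS L Δ lam2 f * Gzero L lam2) :
    P2closedFull.eval (xTrue L Δ lam2 f (Δ * f (K1 L)))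
      = ((2 * Real.pi / L) ^ 2) ^ 3 * ∑ k ∈ (Finset.univ : Finset (Tor L)).erase 0, cK L Δ lam2 f k ^ 3 := by
  set X := xTrue L Δ lam2 f (Δ * f (K1 L)) with hXdef
  obtain ⟨_, dcs, _, ddd, _⟩ := dict_at_xTrue L Δ lam2 f hL hΔ0 hΔ1 hf hlam
  obtain ⟨hX1, hX4, hX5⟩ : X 1 = Real.pi ^ 2 ∧ X 4 = (2 * Real.pi / L) ^ (2 * 2) * S2n L lam2 ∧
      X 5 = (2 * Real.pi / L) ^ (2 * 3) * S3n L lam2 := xTrue_145 L Δ lam2 f (Δ * f (K1 L))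
  have hX0 : X 0 = (2 * Real.pi / L) ^ 2 := xTrue_zero L Δ lam2 f _
  have hS1 : S1h.eval X = (2 * Real.pi / L) ^ 2 * S1n L lam2 := S1h_eval L Δ lam2 f hL hΔ0 hΔ1 hf hlam hu
  have hLpos : (0 : ℝ) < L := by exact_mod_cast (show 0 < L by omega)
  have hexp := pi2ClosedExpansion_holds L Δ lam2 f
  dsimp only at hexp
  rw [hexp]
  have e : P2closedFull.eval X = -(8 * cs.eval X ^ 3 * X 5 + 12 * cs.eval X ^ 2 * dd.eval X * X 0 * X 4
      + 6 * cs.eval X * dd.eval X ^ 2 * X 0 ^ 2 * S1h.eval X + dd.eval X ^ 3 * X 0 ^ 2 * (4 * X 1 - X 0)) := by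
    simp only [P2closedFull, rsum, cube, RExpr.eval, cst, vS3, vS2, vT, vPi2]; push_cast; ring
  rw [e, dcs, ddd, hX0, hX1, hX4, hX5, hS1]
  unfold dPar
  have hπ2 : Real.pi ^ 2 = (2 * Real.pi / (L : ℝ)) ^ 2 * (L : ℝ) ^ 2 / 4 := by
    field_simp
    ring
  rw [hπ2, pow_mul, pow_mul]
  ring

/-- `P2tailFull ↦ θ⁶Σ_{k≠0} pMaj(k)`. -/
theorem eval_P2tailFull (hL : 12 ≤ L) (hΔ0 : 0 ≤ Δ) (hΔ1 : Δ < 1) (hf : IsGroundTwoMagnon L Δ lam2 f) (hlam : 0 < lam2)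
    (h2 : 2 * lam2 < eps1 L) (hu : 0 < cS L Δ lam2 f * Gzero L lam2) :
    P2tailFull.eval (xTrue L Δ lam2 f (Δ * f (K1 L)))
      = ((2 * Real.pi / L) ^ 2) ^ 3 * ∑ k ∈ (Finset.univ : Finset (Tor L)).erase 0, pMaj L Δ lam2 f k := by
  set X := xTrue L Δ lam2 f (Δ * f (K1 L)) with hXdef
  obtain ⟨_, dcs, _, ddd, _⟩ := dict_at_xTrue L Δ lam2 f (by omega) hΔ0 hΔ1 hf hlam
  obtain ⟨hX1, hX4, hX5⟩ : X 1 = Real.pi ^ 2 ∧ X 4 = (2 * Real.pi / L) ^ (2 * 2) * S2n L lam2 ∧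
      X 5 = (2 * Real.pi / L) ^ (2 * 3) * S3n L lam2 := xTrue_145 L Δ lam2 f (Δ * f (K1 L))
  have hX0 : X 0 = (2 * Real.pi / L) ^ 2 := xTrue_zero L Δ lam2 f _
  have hS1 : S1h.eval X = (2 * Real.pi / L) ^ 2 * S1n L lam2 := S1h_eval L Δ lam2 f (by omega) hΔ0 hΔ1 hf hlam hu
  have hk : kap.eval X = _ := kap_eval L Δ lam2 f hL hΔ0 hΔ1 hf hlam h2 hu
  have e : P2tailFull.eval X = 3 * kap.eval X * (4 * cs.eval X ^ 2 * X 5 + 4 * cs.eval X * dd.eval X * X 0 * X 4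
        + dd.eval X ^ 2 * X 0 ^ 2 * S1h.eval X)
      + 3 * kap.eval X ^ 2 * (2 * cs.eval X * X 5 + dd.eval X * X 0 * X 4) + kap.eval X ^ 3 * X 5 := by
    simp only [P2tailFull, rsum, cube, RExpr.eval, cst, vS3, vS2, vT]; push_cast; ring
  rw [e, hk, dcs, ddd, hX0, hX4, hX5, hS1]
  -- the named sums
  set κ : ℝ := kapHat L Δ lam2 f 2 + 2 * aPar L Δ f * cS L Δ lam2 f / (L : ℝ) ^ 2 with hκ
  set E0 := (Finset.univ : Finset (Tor L)).erase 0 with hE0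
  have eg3 : ∑ k ∈ E0, 3 * κ * (2 * cS L Δ lam2 f * gres L lam2 k + dPar L Δ f) ^ 2 * gres L lam2 k
      = 3 * κ * (4 * cS L Δ lam2 f ^ 2 * S3n L lam2 + 4 * cS L Δ lam2 f * dPar L Δ f * S2n L lam2
          + dPar L Δ f ^ 2 * S1n L lam2) := by
    rw [S3n_eq, S2n_eq, S1n_eq, ← sum_erase_zero_gres_pow L lam2 3 (by norm_num),
      ← sum_erase_zero_gres_pow L lam2 2 (by norm_num), ← sum_erase_zero_gres L lam2, ← hE0,
      Finset.mul_sum, Finset.mul_sum, Finset.mul_sum, ← Finset.sum_add_distrib, ← Finset.sum_add_distrib, Finset.mul_sum]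
    refine Finset.sum_congr rfl fun k _ => ?_
    ring
  have eg2 : ∑ k ∈ E0, 3 * κ ^ 2 * (2 * cS L Δ lam2 f * gres L lam2 k + dPar L Δ f) * gres L lam2 k ^ 2
      = 3 * κ ^ 2 * (2 * cS L Δ lam2 f * S3n L lam2 + dPar L Δ f * S2n L lam2) := by
    rw [S3n_eq, S2n_eq, ← sum_erase_zero_gres_pow L lam2 3 (by norm_num),
      ← sum_erase_zero_gres_pow L lam2 2 (by norm_num), ← hE0, Finset.mul_sum, Finset.mul_sum, ← Finset.sum_add_distrib,
      Finset.mul_sum]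
    refine Finset.sum_congr rfl fun k _ => ?_
    ring
  have eg1 : ∑ k ∈ E0, κ ^ 3 * gres L lam2 k ^ 3 = κ ^ 3 * S3n L lam2 := by
    rw [S3n_eq, ← sum_erase_zero_gres_pow L lam2 3 (by norm_num), ← hE0, Finset.mul_sum]
  have hsum : ∑ k ∈ E0, pMaj L Δ lam2 f k
      = 3 * κ * (4 * cS L Δ lam2 f ^ 2 * S3n L lam2 + 4 * cS L Δ lam2 f * dPar L Δ f * S2n L lam2
          + dPar L Δ f ^ 2 * S1n L lam2)
        + 3 * κ ^ 2 * (2 * cS L Δ lam2 f * S3n L lam2 + dPar L Δ f * S2n L lam2) + κ ^ 3 * S3n L lam2 := by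
    unfold pMaj
    dsimp only
    rw [← hκ, Finset.sum_add_distrib, Finset.sum_add_distrib, eg3, eg2, eg1]
  rw [hsum]
  unfold dPar
  rw [pow_mul, pow_mul]
  ring

/-- `P2tailAt q ↦ θ⁶·pMaj(k)` on the grid. -/
theorem eval_P2tailAt (hL : 12 ≤ L) (hΔ0 : 0 ≤ Δ) (hΔ1 : Δ < 1) (hf : IsGroundTwoMagnon L Δ lam2 f) (hlam : 0 < lam2)
    (h2 : 2 * lam2 < eps1 L) (hu : 0 < cS L Δ lam2 f * Gzero L lam2) {q : ℤ × ℤ} (hq : q ∈ gridPts 3) :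
    (P2tailAt 3 q).eval (xTrue L Δ lam2 f (Δ * f (K1 L))) = ((2 * Real.pi / L) ^ 2) ^ 3 * pMaj L Δ lam2 f (B1.toTor L q) := by
  set X := xTrue L Δ lam2 f (Δ * f (K1 L)) with hXdef
  have hk : kap.eval X = _ := kap_eval L Δ lam2 f hL hΔ0 hΔ1 hf hlam h2 hu
  obtain ⟨_, hac, _⟩ := eval_closed L Δ lam2 f (by omega) hΔ0 hΔ1 hf hlam hq
  have hG := eval_vG L Δ lam2 f hq (Δ * f (K1 L))
  have e : (P2tailAt 3 q).eval X = 3 * kap.eval X * (ach 3 q).eval X ^ 2 * (vG 3 q).eval X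
      + 3 * kap.eval X ^ 2 * (ach 3 q).eval X * (vG 3 q).eval X ^ 2 + kap.eval X ^ 3 * (vG 3 q).eval X ^ 3 := by
    simp only [P2tailAt, rsum, cube, RExpr.eval, cst]; push_cast; ring
  rw [e, hk, hac, hG]
  unfold pMaj
  ring

/-! ## ★ The object `P̂` is in its bracket -/

/-- ★★ **`P̂ = θ⁶Σ_k F₂(k)³ ∈ [P2lo, P2hi]` at the true vector** (ground profile, `L ≥ 16`, `0 ≤ Δ < 1`, `c_sG̃(0) > 0`). -/
theorem pHat_mem (hL : 16 ≤ L) (hΔ0 : 0 ≤ Δ) (hΔ1 : Δ < 1) (hf : IsGroundTwoMagnon L Δ lam2 f) (hlam : 0 < lam2)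
    (h2 : 2 * lam2 < eps1 L) (hu : 0 < cS L Δ lam2 f * Gzero L lam2) :
    (P2lo 2).eval (xTrue L Δ lam2 f (Δ * f (K1 L))) ≤ ((2 * Real.pi / L) ^ 2) ^ 3 * ∑ k : Tor L, F2 L f k ^ 3 ∧
    ((2 * Real.pi / L) ^ 2) ^ 3 * ∑ k : Tor L, F2 L f k ^ 3 ≤ (P2hi 2).eval (xTrue L Δ lam2 f (Δ * f (K1 L))) := by
  classical
  set X := xTrue L Δ lam2 f (Δ * f (K1 L)) with hXdef
  set t : ℝ := (2 * Real.pi / L) ^ 2 with htdef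
  have hLpos : (0 : ℝ) < L := by exact_mod_cast (show 0 < L by omega)
  have ht0 : 0 ≤ t := by positivity
  have ht3 : 0 ≤ t ^ 3 := by positivity
  -- the pieces
  have hF0 : F0h.eval X = t * F2 L f 0 := eval_F0h L Δ lam2 f (by omega) hΔ0 hΔ1 hf hlam
  have hFh : ∀ q ∈ gridPts 2, (Fh 3 q).eval X = t * F2 L f (B1.toTor L q) :=
    fun q hq => eval_Fh L Δ lam2 f (by omega) hΔ0 hΔ1 hf hlam (gridPts_two_sub q hq)
  have hch : ∀ q ∈ gridPts 2, (ch 3 q).eval X = t * cK L Δ lam2 f (B1.toTor L q) :=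
    fun q hq => (eval_closed L Δ lam2 f (by omega) hΔ0 hΔ1 hf hlam (gridPts_two_sub q hq)).1
  have htl : ∀ q ∈ gridPts 2, (P2tailAt 3 q).eval X = t ^ 3 * pMaj L Δ lam2 f (B1.toTor L q) :=
    fun q hq => eval_P2tailAt L Δ lam2 f (by omega) hΔ0 hΔ1 hf hlam h2 hu (gridPts_two_sub q hq)
  have hcl : P2closedFull.eval X = t ^ 3 * ∑ k ∈ (Finset.univ : Finset (Tor L)).erase 0, cK L Δ lam2 f k ^ 3 :=
    eval_P2closedFull L Δ lam2 f (by omega) hΔ0 hΔ1 hf hlam hu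
  have htf : P2tailFull.eval X = t ^ 3 * ∑ k ∈ (Finset.univ : Finset (Tor L)).erase 0, pMaj L Δ lam2 f k :=
    eval_P2tailFull L Δ lam2 f (by omega) hΔ0 hΔ1 hf hlam h2 hu
  -- block list sums ↦ Finset sums
  have bF : ((block1 2).map fun q => (cube (Fh 3 q)).eval X).sum = t ^ 3 * ∑ k ∈ Fibre3.block1 L 2, F2 L f k ^ 3 := by
    rw [block1_sum_eq L (by omega), ← List.sum_map_mul_left]
    refine congrArg List.sum (List.map_congr_left fun q hq => ?_)
    rw [eval_cube, hFh q hq]; ring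
  have bC : ((block1 2).map fun q => (cube (ch 3 q)).eval X).sum = t ^ 3 * ∑ k ∈ Fibre3.block1 L 2, cK L Δ lam2 f k ^ 3 := by
    rw [block1_sum_eq L (by omega), ← List.sum_map_mul_left]
    refine congrArg List.sum (List.map_congr_left fun q hq => ?_)
    rw [eval_cube, hch q hq]; ring
  have bT : ((block1 2).map fun q => (P2tailAt 3 q).eval X).sum = t ^ 3 * ∑ k ∈ Fibre3.block1 L 2, pMaj L Δ lam2 f k := by
    rw [block1_sum_eq L (by omega), ← List.sum_map_mul_left]
    exact congrArg List.sum (List.map_congr_left fun q hq => htl q hq)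
  -- the two brackets evaluated
  have core : ∀ s : ℝ, (rsum [cube F0h, rsum ((block1 2).map fun q => cube (Fh 3 q)), P2closedFull,
      .neg (rsum ((block1 2).map fun q => cube (ch 3 q)))]).eval X + s
      = t ^ 3 * (F2 L f 0 ^ 3 + ∑ k ∈ Fibre3.block1 L 2, F2 L f k ^ 3
        + (∑ k ∈ (Finset.univ : Finset (Tor L)).erase 0, cK L Δ lam2 f k ^ 3 - ∑ k ∈ Fibre3.block1 L 2, cK L Δ lam2 f k ^ 3)) + s := by
    intro s
    simp only [rsum, RExpr.eval, eval_rsum, List.map_map]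
    rw [eval_cube, hF0, hcl]
    have h1 : (List.map ((fun e => e.eval X) ∘ fun q => cube (Fh 3 q)) (block1 2)).sum
        = t ^ 3 * ∑ k ∈ Fibre3.block1 L 2, F2 L f k ^ 3 := by rw [← bF]; rfl
    have h2 : (List.map ((fun e => e.eval X) ∘ fun q => cube (ch 3 q)) (block1 2)).sum
        = t ^ 3 * ∑ k ∈ Fibre3.block1 L 2, cK L Δ lam2 f k ^ 3 := by rw [← bC]; rfl
    rw [h1, h2]; ring
  have tailv : (RExpr.max (.sub P2tailFull (rsum ((block1 2).map fun q => P2tailAt 3 q))) (cst 0)).eval X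
      = max (t ^ 3 * (∑ k ∈ (Finset.univ : Finset (Tor L)).erase 0, pMaj L Δ lam2 f k
          - ∑ k ∈ Fibre3.block1 L 2, pMaj L Δ lam2 f k)) 0 := by
    simp only [RExpr.eval, eval_rsum, List.map_map, cst]
    have h3 : (List.map ((fun e => e.eval X) ∘ fun q => P2tailAt 3 q) (block1 2)).sum
        = t ^ 3 * ∑ k ∈ Fibre3.block1 L 2, pMaj L Δ lam2 f k := by rw [← bT]; rfl
    rw [htf, h3]; push_cast; congr 1; ring
  have cval := core 0
  simp only [add_zero] at cval
  have ehi : (P2hi 2).eval X = (rsum [cube F0h, rsum ((block1 2).map fun q => cube (Fh 3 q)), P2closedFull,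
      .neg (rsum ((block1 2).map fun q => cube (ch 3 q)))]).eval X
      + (RExpr.max (.sub P2tailFull (rsum ((block1 2).map fun q => P2tailAt 3 q))) (cst 0)).eval X := by
    simp only [P2hi, rsum, RExpr.eval, Nat.reduceAdd]; ring
  have elo : (P2lo 2).eval X = (rsum [cube F0h, rsum ((block1 2).map fun q => cube (Fh 3 q)), P2closedFull,
      .neg (rsum ((block1 2).map fun q => cube (ch 3 q)))]).eval X
      + -(RExpr.max (.sub P2tailFull (rsum ((block1 2).map fun q => P2tailAt 3 q))) (cst 0)).eval X := by
    simp only [P2lo, rsum, RExpr.eval, Nat.reduceAdd]; ring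
  rw [ehi, elo, cval, tailv]
  -- the true sum decomposed
  have split := OuterMaj.singleRegionSplit_holds L 2 (by omega) (fun k => F2 L f k ^ 3)
  have hout : ∑ k ∈ Fibre3.outer1 L 2, F2 L f k ^ 3
      = (∑ k ∈ (Finset.univ : Finset (Tor L)).erase 0, cK L Δ lam2 f k ^ 3 - ∑ k ∈ Fibre3.block1 L 2, cK L Δ lam2 f k ^ 3)
        + ∑ k ∈ Fibre3.outer1 L 2, (F2 L f k ^ 3 - cK L Δ lam2 f k ^ 3) := by
    rw [← outer1_sum_eq L (by omega), ← Finset.sum_add_distrib]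
    refine Finset.sum_congr rfl fun k _ => ?_; ring
  have hbd := OuterMaj.pi2_outer_bound L (by omega) hΔ0 hΔ1 hf 2 (by omega)
    (OuterMaj.f2ClosedPlusTail_holds L (by omega) hΔ0) (OuterMaj.outerEnergyFloor_holds L 2)
  have hmaj : ∑ k ∈ Fibre3.outer1 L 2, pMaj L Δ lam2 f k
      = ∑ k ∈ (Finset.univ : Finset (Tor L)).erase 0, pMaj L Δ lam2 f k - ∑ k ∈ Fibre3.block1 L 2, pMaj L Δ lam2 f k :=
    outer1_sum_eq L (by omega) _
  have habs : |∑ k ∈ Fibre3.outer1 L 2, (F2 L f k ^ 3 - cK L Δ lam2 f k ^ 3)| ≤ ∑ k ∈ Fibre3.outer1 L 2, pMaj L Δ lam2 f k := by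
    refine hbd.trans (le_of_eq ?_)
    refine Finset.sum_congr rfl fun k _ => ?_
    unfold pMaj; ring
  rw [hmaj] at habs
  obtain ⟨hlow, hupp⟩ := abs_le.1 habs
  have key : t ^ 3 * ∑ k : Tor L, F2 L f k ^ 3
      = t ^ 3 * (F2 L f 0 ^ 3 + ∑ k ∈ Fibre3.block1 L 2, F2 L f k ^ 3
        + (∑ k ∈ (Finset.univ : Finset (Tor L)).erase 0, cK L Δ lam2 f k ^ 3 - ∑ k ∈ Fibre3.block1 L 2, cK L Δ lam2 f k ^ 3))
        + t ^ 3 * ∑ k ∈ Fibre3.outer1 L 2, (F2 L f k ^ 3 - cK L Δ lam2 f k ^ 3) := by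
    rw [split, hout]; ring
  rw [key]
  have hm1 := le_max_left (t ^ 3 * (∑ k ∈ (Finset.univ : Finset (Tor L)).erase 0, pMaj L Δ lam2 f k
          - ∑ k ∈ Fibre3.block1 L 2, pMaj L Δ lam2 f k)) 0
  have hA := mul_le_mul_of_nonneg_left hupp ht3
  have hB := mul_le_mul_of_nonneg_left hlow ht3
  constructor
  · nlinarith
  · nlinarith

end Summit.HubbardSuperconductivity.HubbardSuperconductivity.Theorems.AnisotropyChord.Transfer.Fibre3.L2.N1
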